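import Summits.Ventures.HSemireg.EquidistributionDesignsN4

/-!
# Venture HSemireg — **COROLLARY EQD-H** (hyperplane-flip symmetry of slanted designs): for `n + 2 ≥ 2` coordinates, every coordinate
# `j`, value `c` and sign vector `s`, the slab count `N_s(z_j = c)` is unchanged when `s_j` is flipped — FILED VERBATIM from t-22 g5's
# kernel file (the part `EquidistributionDesignsN4.lean` names as «NOT cut: … COROLLARY EQD-H (slabs)»)

HONEST FRAMING. Part of the Lean index of the computation cell `pub-hsemireg` (filed by the Sunday typer seat p9 g3, § g = 8; AUTHOR
of the mathematics and of the Lean text: seat t-22 g5, folder-local file `target-g8/t22/out/gf2/EQD.lean` sha256∕16 `91feb766668004a7`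
(= `target-g8/t21/reruns/EQD_t22_91feb766668004a7.lean`), §§ «Slab embedding along coordinate j with value c» + «EQD-H» l.444–624;
earlier file of record `e35b1ec8611844b8` announced on the bus l.8544 with `T22g5EQD.eqdH` «(axioms propext ∕ Classical.choice ∕
Quot.sound) … proof route = EQD (integer version `eqd_core`) applied to the signed slab-difference design on the other n+1 coordinates
(README §8d∕§8e; standalone EQDH.lean c4d790c9c3989d0a checks in 6 s)»; re-checked rc 0 by t-21 g7 (census rows P22-5′ ∕ P22-6:
«COROLLARY EQD-H T22g5EQD.eqdH … statement read — … faithful to README §8d»); CENSUS-g8 v1.274 `7744dc4867915f69`). FINITE CHARACTER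
SUMS over `(ZMod 3)^(n+2) × Bool^(n+2)` ONLY: no variety, no sheaf, no semiregularity map; nothing here says that HC ∕ HC_CM ∕ HC_AV
holds; no Literature fact is declared or used. The bridge to designs on `E_K^{2n}` (s0-3's MODEL THEOREM, door P) is NOT part of this
file — as in the parent file.

WHAT IS CUT (verbatim, namespace `T22g5EQD` ↦ `Summit.Ventures.HSemireg.EQD`, five one-line docstrings added — `j_not_mem_map`,
`chi_liftSet`, `liftSet_nonempty`, `liftSet_ne_univ`, `liftSet_univ`; nothing else changed): the slab reindexing `sum_slab` ∕
`sum_signs_split`, the lifted coordinate set `liftSet` with `chi_liftSet` ∕ `liftSet_nonempty` ∕ `liftSet_ne_univ` ∕ `liftSet_univ`,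
`slab_colsum_zero` ((M_S) fibrewise ⇒ the slab column sum vanishes when `j ∈ S`), and **`eqdH`**: under the SAME binders as the tree's
`eqd` (zero-sum `f`, (M_S) for every proper non-empty `S`, (T)), for every `j`, `c`, `s`:
`Σ_{z : z_j = c} m z s = Σ_{z : z_j = c} m z (s with s_j flipped)` — proof = the tree's `eqd_core` applied to the signed slab-difference
design `d z' a' = m (ins z') (a', s_j := false) − m (ins z') (a', s_j := true)` on the remaining `n + 1` coordinates, whose column sums
vanish for every non-empty `S'` and whose total mass is `0`. Uses from the parent tree file: `σ`, `σ_true`, `σ_false`, `chi`,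
`chi_empty`, `eqd_core`, `sum_total`, `f_three_shifts`.
-/

open Finset

namespace Summit.Ventures.HSemireg.EQD

/-! ## Slab embedding along coordinate `j` with value `c`. -/

section slab
variable {n : ℕ} (j : Fin (n + 2))

/-- reindex a sum over the slab `{z : z j = c}` by the remaining coordinates. -/
theorem sum_slab {α β : Type*} [Fintype α] [DecidableEq α] [AddCommMonoid β] (c : α) (G : (Fin (n + 2) → α) → β) :
    ∑ z ∈ (univ.filter fun z : Fin (n + 2) → α => z j = c), G z = ∑ z' : Fin (n + 1) → α, G (Fin.insertNth j c z') := by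
  rw [Finset.sum_filter]
  rw [← Fintype.sum_equiv (Fin.insertNthEquiv (fun _ => α) j)
        (fun p => if (Fin.insertNth j p.1 p.2 : Fin (n + 2) → α) j = c then G (Fin.insertNth j p.1 p.2) else 0)
        (fun z => if z j = c then G z else 0) (fun _ => rfl)]
  rw [Fintype.sum_prod_type]
  simp only [Fin.insertNth_apply_same]
  rw [Finset.sum_comm]
  simp [Finset.sum_ite_eq']

/-- reindex a sum over all sign vectors by (value at `j`, the rest). -/
theorem sum_signs_split {β : Type*} [AddCommMonoid β] (H : (Fin (n + 2) → Bool) → β) :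
    ∑ a : Fin (n + 2) → Bool, H a = ∑ a' : Fin (n + 1) → Bool, (H (Fin.insertNth j true a') + H (Fin.insertNth j false a')) := by
  rw [← Fintype.sum_equiv (Fin.insertNthEquiv (fun _ => Bool) j) (fun p => H (Fin.insertNth j p.1 p.2)) H (fun _ => rfl)]
  rw [Fintype.sum_prod_type, Fintype.sum_bool, ← Finset.sum_add_distrib]

/-- the lifted coordinate set `S = {j} ∪ j.succAbove(S')`. -/
def liftSet (S' : Finset (Fin (n + 1))) : Finset (Fin (n + 2)) := insert j (S'.map (Fin.succAboveEmb j))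

/-- `j ∉ j.succAbove(S')`. -/
theorem j_not_mem_map (S' : Finset (Fin (n + 1))) : j ∉ S'.map (Fin.succAboveEmb j) := by
  simp [Finset.mem_map, Fin.succAbove_ne]

/-- `χ_{liftSet j S'}(ins_j b a') = σ b · χ_{S'}(a')`. -/
theorem chi_liftSet (S' : Finset (Fin (n + 1))) (b : Bool) (a' : Fin (n + 1) → Bool) :
    chi (liftSet j S') (Fin.insertNth j b a') = σ b * chi S' a' := by
  unfold chi liftSet
  rw [Finset.prod_insert (j_not_mem_map j S'), Fin.insertNth_apply_same, Finset.prod_map]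
  congr 1
  refine Finset.prod_congr rfl (fun k _ => ?_)
  simp [Fin.insertNth_apply_succAbove]

/-- the lifted set is non-empty (it contains `j`). -/
theorem liftSet_nonempty (S' : Finset (Fin (n + 1))) : (liftSet j S').Nonempty := by
  unfold liftSet; exact Finset.insert_nonempty _ _

/-- the lifted set of a proper `S'` is proper. -/
theorem liftSet_ne_univ {S' : Finset (Fin (n + 1))} (h : S' ≠ univ) : liftSet j S' ≠ univ := by
  obtain ⟨k, hk⟩ : ∃ k, k ∉ S' := by
    by_contra hc; push Not at hc; exact h (Finset.eq_univ_of_forall hc)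
  intro hU
  have : j.succAbove k ∈ liftSet j S' := by rw [hU]; exact Finset.mem_univ _
  unfold liftSet at this
  rw [Finset.mem_insert] at this
  rcases this with h1 | h2
  · exact Fin.succAbove_ne j k h1
  · rw [Finset.mem_map] at h2
    obtain ⟨k', hk', hkk⟩ := h2
    have : k' = k := by simpa using hkk
    exact hk (this ▸ hk')

/-- the lifted set of `univ` is `univ`. -/
theorem liftSet_univ : liftSet j (univ : Finset (Fin (n + 1))) = univ := by
  unfold liftSet
  ext i
  simp only [Finset.mem_insert, Finset.mem_map, Finset.mem_univ, true_and, iff_true]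
  by_cases h : i = j
  · exact Or.inl h
  · obtain ⟨k, hk⟩ := Fin.exists_succAbove_eq h
    exact Or.inr ⟨k, by simpa using hk⟩

end slab

/-! ## EQD-H -/

/-- the slab sum `Σ_{z : z_j = c} Σ_a m z a χ_S(a)` vanishes for `S = liftSet j S'` with `S' ≠ univ`, by (M_S) fibrewise
(the slab is a union of `S`-fibres because `j ∈ S`). -/
theorem slab_colsum_zero {n : ℕ} (j : Fin (n + 2)) (c : ZMod 3)
    (m : (Fin (n + 2) → ZMod 3) → (Fin (n + 2) → Bool) → ℤ) (S : Finset (Fin (n + 2))) (hj : j ∈ S)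
    (hMS : ∀ zS : S → ZMod 3, ∑ z ∈ (univ.filter fun z : Fin (n + 2) → ZMod 3 => (fun k : S => z k) = zS),
        ∑ a, m z a * chi S a = 0) :
    ∑ z ∈ (univ.filter fun z : Fin (n + 2) → ZMod 3 => z j = c), ∑ a, m z a * chi S a = 0 := by
  rw [← Finset.sum_fiberwise (univ.filter fun z : Fin (n + 2) → ZMod 3 => z j = c) (fun z : Fin (n + 2) → ZMod 3 => (fun k : S => z k))
        (fun z => ∑ a, m z a * chi S a)]
  refine Finset.sum_eq_zero (fun zS _ => ?_)
  by_cases h : zS ⟨j, hj⟩ = c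
  · rw [← hMS zS]
    congr 1
    ext z
    simp only [Finset.mem_filter, Finset.mem_univ, true_and, and_iff_right_iff_imp]
    intro hz
    have := congrFun hz ⟨j, hj⟩
    simp only at this
    rw [this]; exact h
  · refine Finset.sum_eq_zero (fun z hz => ?_)
    exfalso
    simp only [Finset.mem_filter, Finset.mem_univ, true_and] at hz
    obtain ⟨hz1, hz2⟩ := hz
    have := congrFun hz2 ⟨j, hj⟩
    simp only at this
    exact h (this ▸ hz1)

/-- **COROLLARY EQD-H.** For `n + 2 ≥ 2` coordinates: `N_s(z_j = c) = N_{s^(j)}(z_j = c)`. -/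
theorem eqdH (n : ℕ) (m : (Fin (n + 2) → ZMod 3) → (Fin (n + 2) → Bool) → ℤ) (f : ZMod 3 → ℤ)
    (hf : f 0 + f 1 + f 2 = 0)
    (hM : ∀ S : Finset (Fin (n + 2)), S.Nonempty → S ≠ univ →
      ∀ zS : S → ZMod 3, ∑ z ∈ (univ.filter fun z : Fin (n + 2) → ZMod 3 => (fun k : S => z k) = zS),
        ∑ a, m z a * chi S a = 0)
    (hT : ∀ z : Fin (n + 2) → ZMod 3, ∑ a, m z a * chi univ a = f (∑ k, z k))
    (j : Fin (n + 2)) (c : ZMod 3) (s : Fin (n + 2) → Bool) :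
    ∑ z ∈ (univ.filter fun z : Fin (n + 2) → ZMod 3 => z j = c), m z s
      = ∑ z ∈ (univ.filter fun z : Fin (n + 2) → ZMod 3 => z j = c), m z (Function.update s j (!s j)) := by
  -- the signed slab-difference design on the remaining n+1 coordinates
  set d : (Fin (n + 1) → ZMod 3) → (Fin (n + 1) → Bool) → ℤ :=
    fun z' a' => m (Fin.insertNth j c z') (Fin.insertNth j false a') - m (Fin.insertNth j c z') (Fin.insertNth j true a') with hd
  -- conversion: slab column sum of m for S = liftSet j S'  =  column sum of d for S'
  have conv : ∀ S' : Finset (Fin (n + 1)),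
      ∑ z ∈ (univ.filter fun z : Fin (n + 2) → ZMod 3 => z j = c), ∑ a, m z a * chi (liftSet j S') a
        = ∑ z', ∑ a', d z' a' * chi S' a' := by
    intro S'
    rw [sum_slab j c]
    refine Finset.sum_congr rfl (fun z' _ => ?_)
    rw [sum_signs_split j]
    refine Finset.sum_congr rfl (fun a' _ => ?_)
    rw [chi_liftSet, chi_liftSet, hd]
    simp only [σ_true, σ_false]
    ring
  -- column sums of d vanish for every non-empty S'
  have hcol : ∀ S' : Finset (Fin (n + 1)), S'.Nonempty → ∑ z', ∑ a', d z' a' * chi S' a' = 0 := by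
    intro S' _
    rw [← conv S']
    by_cases hU : S' = univ
    · -- S = univ: Σ_{slab} f(Σ z) = 3^n (f(c) + f(c+1) + f(c+2)) = 0
      subst hU
      rw [liftSet_univ]
      simp_rw [hT]
      rw [sum_slab j c]
      have hins : ∀ z' : Fin (n + 1) → ZMod 3, ∑ k, (Fin.insertNth j c z' : Fin (n + 2) → ZMod 3) k = c + ∑ k, z' k := by
        intro z'
        rw [Fin.sum_univ_succAbove _ j]
        simp [Fin.insertNth_apply_same, Fin.insertNth_apply_succAbove]
      simp_rw [hins]
      rw [sum_total n (fun x => f (c + x))]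
      have : f (c + 0) + f (c + 1) + f (c + 2) = f 0 + f 1 + f 2 := by rw [add_zero]; exact f_three_shifts f c
      rw [this, hf, mul_zero]
    · exact slab_colsum_zero j c m (liftSet j S') (by unfold liftSet; exact Finset.mem_insert_self _ _)
        (hM _ (liftSet_nonempty j S') (liftSet_ne_univ j hU))
  -- total mass of d vanishes (from (M_{{j}}))
  have hmass : ∑ z', ∑ a', d z' a' = 0 := by
    have h0 := conv ∅
    simp only [chi_empty, mul_one] at h0
    rw [← h0]
    have hne : liftSet j (∅ : Finset (Fin (n + 1))) ≠ univ := liftSet_ne_univ j (by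
      intro h; have := Finset.card_eq_zero.mpr rfl |>.symm.trans (congrArg Finset.card h); simp at this)
    exact slab_colsum_zero j c m (liftSet j ∅) (by unfold liftSet; exact Finset.mem_insert_self _ _)
      (hM _ (liftSet_nonempty j ∅) hne)
  -- EQD core on d
  have key := eqd_core d hcol (j.removeNth s)
  rw [hmass] at key
  have hNd : ∑ z', d z' (j.removeNth s) = 0 := by
    have h2 : (2 : ℤ) ^ (n + 1) ≠ 0 := pow_ne_zero _ (by norm_num)
    rcases mul_eq_zero.mp key with h | h
    · exact absurd h h2
    · exact h
  -- unfold d and express both slab sums through insertNth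
  rw [sum_slab j c, sum_slab j c]
  have hs : ∀ b : Bool, Fin.insertNth j b (j.removeNth s) = Function.update s j b := by
    intro b
    ext i
    by_cases h : i = j
    · subst h; simp [Fin.insertNth_apply_same]
    · obtain ⟨k, rfl⟩ := Fin.exists_succAbove_eq h
      rw [Fin.insertNth_apply_succAbove, Function.update_of_ne (Fin.succAbove_ne j k)]
      rfl
  have hself : Function.update s j (s j) = s := Function.update_eq_self j s
  simp only [hd] at hNd
  rw [Finset.sum_sub_distrib, sub_eq_zero, hs, hs] at hNd
  cases hsj : s j
  · -- s j = false: N_s = Σ m (ins z') (update s j false) = Σ m (ins z') (update s j true) = N_flip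
    rw [hsj] at hself
    simp only [Bool.not_false]
    rw [hself] at hNd
    exact hNd
  · rw [hsj] at hself
    simp only [Bool.not_true]
    rw [hself] at hNd
    exact hNd.symm

end Summit.Ventures.HSemireg.EQD
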